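import Literature.MathematicalPhysics.QuantumFieldTheory.Balaban1983to89.NodeOLettersOfWalks

/-!
# `Balaban1983to89.NodeOLettersOfWalksAcross` — THE (B1) INPUT OF RECORD TYPED ACROSS A FAMILY OF (2.14)-TERMS ∕ TORI:
# ONE sixteen-constant package of joint walk expansions ([Balaban1985BackgroundPropagators] Thm 3.10 shape) + accretivity +
# volume sums (`UniformWalksAcross`), its rate book, and NODE O's binder `ExistsUniformAcrossSmall` FROM IT, by name

statement-level bookkeeping over published theorems with citation tags; kernel-checked compositions of tree theorems; nothing here is a
claim about the Yang–Mills mass gap.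

Cell `pub-ymgap`, D-0062 Track A, node N10 = [Balaban1988RG2Cluster] Lemmas 1–3; seat `dag-n10-b` g5 (-b FIRST-MISSING-ESTIMATE); v1.0.1 =
one docstring clause at `TermWalks` (READ-338 (A3)), declarations byte-identical.  WHY.
The per-term (B1) input of record is `NodeOLettersOfWalks.termLetters_of_walks₂` (v1.1, p438545): `TermLetters` of ONE «local factor ×
square root» (2.14)-term from three joint walk expansions (local factor `L`, full precision `P`, term precision `A2`) + two accretivity
constants + the (2.7) reading `G2 = L·P^{−1/2}` + five volume sums + far-ness + SEVEN derived rates with TWENTY side inequalities.  NODE O's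
binder of record, `B13TermWalkDataOneTorus.ExistsUniformAcrossSmall 𝓣 α R_σ0 θ₀` (:353), quantifies over EVERY term of EVERY member of a
family `𝓣 : S → TorusTerms c d` (member = scale ∕ history ∕ torus ∕ domain) and asks for ONE constant package.  Between the two sat
≈ 45 binders per term and a rate bookkeeping whose order of choices matters (the cell's discharge referee, READ-330 (ii): the order
`(κ_P, m, K̄_P) & c_V₀ ⟹ κ ⟹ θ′, η ⟹ c_V ⟹ κ_C` quoted at `termLetters_of_walks₂` was recorded only in a memo cell, *"mark it or
land it"*).  This file LANDS it: the family-level statement, the rate book as data, the composition to NODE O's binder, and the two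
residual smallness sources of print as explicit thresholds.
* §1 `volume_mono` (public home), `m_le_of_accretive` (accretivity constant ≤ a diagonal entry bound, test vector `δ_{i₀}`), and the arithmetic
  core `single_constant_constraint(')` of the slot guard located on the single-constant capstone `termLetters_of_walks` (its rate
  hypotheses force `16K̄_P·η·c_V ≤ mκ_P`; kernel record of WHY the two-constant edition is the input of record — §6 of
  `NodeOLettersOfWalks`).
* §2 `WalkPackage` (the sixteen reals: `R`; `(ε,κ,K̄)` of `L`, of `P`, of `A2`; `m`, `m_A`; `η`, `c_V`; `c_V₀`; `R_σ`) with
  `Admissible` (signs), the output letter constants `BΓ`, `BΓ'`, `Kbar`; `RateBook q` (the seven derived rates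
  `(κ, θ′, ρ_L, ρ_E, κ_C, ρ₀, ρ′)` WITH their twenty inequalities — data + proofs); `TermWalks 𝒦 q` (Prop: ONE term's W-walks datum
  with package `q` — `X ≠ ∅`, the product reading with expansions of `L` and `P` through `X` and `m`-accretivity of `P`, an expansion
  of `A2` and its `m_A`-accretivity, the five volume sums, far-ness; walk objects and `L`, `P` EXISTENTIAL, only the constants
  exposed); `termLetters_of_termWalks` (= `termLetters_of_walks₂` with the existentials opened); **`UniformWalksAcross 𝓣 q`**
  (`∀ s i`, the member's extra columns finite as `∃`-binders — no instance); **`acrossSmall_of_walks`**: a uniform admissible package,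
  any rate book with `0 < κ_C ≤ ρ′`, `0 ≤ α < R`, `R_σ0 ≤ R_σ` and the exchange inequality `2K̄(e^{−(ρ′−κ_C)R_σ} + α/R) ≤ θ₀` give
  `ExistsUniformAcrossSmall 𝓣 α R_σ0 θ₀` — through `NodeOLetters.acrossSmall_of_letters`, by name.
* §3 NON-CIRCULARITY as data: `WalkPackage.kapStar` (`κ⋆ = min(κ_P/4, mκ_P/(8K̄_Pc_V₀+1))`, a function of `(κ_P, m, K̄_P, c_V₀)`
  only), `rhoE`, `mu` (the master rate, independent of `(η, c_V)`), **`etaMax`** (the admissible ceiling for the volume rate, NOT a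
  function of `(η, c_V)`), `kapCStar` (the only rate reading `c_V`); `PositiveRates`; **`stdRates`** — an inhabitant of `RateBook q`
  for ANY `c_V, c_V₀ ≥ 0` provided `η ≤ etaMax q`; `stdRates_pos` (`0 < κ_C < ρ′ = μ/4`).  ORDER OF CHOICES (no circularity):
  `(κ_P, m, K̄_P)` & `c_V₀ := V(κ_P/2)` ⟹ `κ⋆` ⟹ `μ, etaMax` ⟹ pick `η ∈ (0, etaMax]` ⟹ `c_V := V(η)` ⟹ `κ_C⋆`.
* §4 `acrossSmall_of_walks_thresholds`, `acrossSmall_of_walks_std` — with the rung in hand, what remains of NODE O's smallness is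
  print's two sources only, as explicit thresholds: `α ≤ θ₀R/(4K̄+4)` (the bigger analyticity space, p. 15) and
  `R_σ ≥ log((4K̄+4)/θ₀)/(ρ′−κ_C)` (σ-cubes far from `Z₀`, p. 13's `O(1)e^{−⅓δ₀M}`, `M` large) — for EVERY `θ₀ > 0`.
CHAIN (by name): `UniformWalksAcross 𝓣 q` ⟹ (§2) `ExistsUniformAcrossSmall 𝓣 α R_σ0 θ₀` ⟹ `B13TermWalkDataOneTorus` ∕ `NodeOLetters`
downstream ⟹ L17a ∧ L16a per term ⟹ `B13PrimitiveKernels216.h226_torus_of_kernelBounds` ⟹ (2.26) ⟹ (2.38).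

PROVENANCE.  §1–§4 are the tree edition of the memo cell `ym-nodeO-ideate` (lens P3 «weaken the target», g24) sketch of record
`run/shared/lean/pub/ym-nodeO-ideate/memos/lines/NodeO-walks-rung-v2-P3g24.lean` (sha256 22952973…, 453 l., 2026-08-26T11:18Z; v1 of
that sketch located the slot guard and kernel-checked the two-constant editions now in `NodeOLettersOfWalks` §6), supports-only
evidence rows 48∕53 on `stmt-QuantumFields-19181`; declarations verbatim up to this namespace, docstrings, and the header; adopted by
the n10 lineage per the cell's adoption rule for memo-cell sketches (NODE-TABLE v14).  The same memo cell's v3 (evidence row 54)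
inhabits `UniformWalksAcross` by the model family of `NodeOLettersOfWalksWitness` on all tori — not restated here.

CITATIONS.  [Balaban1988RG2Cluster] (1.11) p. 5, p. 13 (σ₀-cubes; the square root of (2.7); *"discussed in [13] for all operators
determining Δ_k, and for C^{(k)}(Z₀), but not for (C^{(k)})^{1/2}"*), p. 15 (*"The general case is handled by a perturbative
argument"*; the bigger analyticity space), (2.14)–(2.16) pp. 15–16; [Balaban1985BackgroundPropagators] Thm 3.10 ∕ (3.108) p. 416
(*"The constant O(1) depends on d and L only"*), (3.154) p. 427.

HONEST FRAMING: finite-matrix bookkeeping joining tree interfaces by name; NOTHING of Bałaban's operators is constructed; whether HIS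
`C*Δ_k(σ)C_{Z₀ᶜ}`, `C*Δ_k(σ,𝐔,𝐉)C`, `Δ^{(k)}(Z₀,σ)` carry ONE W-walks package across the exhausting family at complex backgrounds
(`UniformWalksAcross 𝓣_Bałaban q`) is the OBJECT-level content of [13] Thm 3.10 ∕ cell GAPS G-B9-10 ∕ in-edge N06 and of the NODE 00
pin — the rung's HYPOTHESIS, not its output; count-neutral Track-A side landing; NOT a discharge of N10; NOT NODE O for Bałaban's
family; NOT [B12] Thm 2; nothing continuum ∕ ℝ⁴ ∕ OS ∕ mass-gap ∕ Clay.  0 `sorry`; `structure`∕`def` = constant packages and rate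
books (bookkeeping data), no instance, no notation; standard axioms.
-/

noncomputable section

namespace Literature.MathematicalPhysics.QuantumFieldTheory.Balaban1983to89.NodeOLettersOfWalksAcross

open Metric Set Finset
open scoped Matrix
open Literature.MathematicalPhysics.QuantumFieldTheory.Balaban1983to89
open Literature.MathematicalPhysics.QuantumFieldTheory.Balaban1983to89.B9Thm37GlueTorus
  (tdist1 tdist1_nonneg tdist1_triangle tdist1_self tdist1_comm)
open Literature.MathematicalPhysics.QuantumFieldTheory.Balaban1983to89.TreeLengthTorus (TPt)
open Literature.MathematicalPhysics.QuantumFieldTheory.Balaban1983to89.B5TorusCover (UT)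
open Literature.MathematicalPhysics.QuantumFieldTheory.Balaban1983to89.B13JointWalkExpansion (JointWalkExpansion)
open Literature.MathematicalPhysics.QuantumFieldTheory.Balaban1983to89.B13TermWalkData (TermKernels TorusTerms)
open Literature.MathematicalPhysics.QuantumFieldTheory.Balaban1983to89.B13TermWalkDataOneTorus (ExistsUniformAcrossSmall)
open Literature.MathematicalPhysics.QuantumFieldTheory.Balaban1983to89.NodeOLetters
  (distX KernelLetters TermLetters acrossSmall_of_letters)
open Literature.MathematicalPhysics.QuantumFieldTheory.Balaban1983to89.NodeOLettersSqrt (kernelLetters_mul)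
open Literature.MathematicalPhysics.QuantumFieldTheory.Balaban1983to89.NodeOLettersSqrtAlmostLocal (kernelLetters_mono_rate)
open Literature.MathematicalPhysics.QuantumFieldTheory.Balaban1983to89.NodeOLettersSqrtExpDecay
  (weightedSums_le_half_of_expDecay kernelLetters_invSqrt_of_expDecay)
open Literature.MathematicalPhysics.QuantumFieldTheory.Balaban1983to89.NodeOLettersOfWalks
  (kbar_nonneg_of_jointWalkExpansion kernelLetters_of_jointWalkExpansion precisionLetters_of_jointWalkExpansion)
open Literature.MathematicalPhysics.QuantumFieldTheory.Balaban1983to89.B13Sqrt27Accretive (invSqrt)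

variable {d N' : ℕ} {ν : ℕ} {Nf : Fin ν → ℕ} [∀ i, NeZero (Nf i)]
variable {E : Type*} [NormedAddCommGroup E] [NormedSpace ℂ E]

/-! ## §1. Elementary lemmas, and the arithmetic core of the slot guard located on the single-constant capstone -/

/-- **Volume sums are antitone in the rate** (`d₁ ≥ 0`): a volume constant at rate `η` serves every rate `θ ≥ η` — the
one-line bookkeeping behind reading ONE `c_V` at several rates (public home of the `private` copy in `NodeOLettersOfWalks`).
[cite: Balaban1984PropagatorsII, Lemma 2.1 (2.61) p.234] -/
theorem volume_mono {ι : Type} [Fintype ι] (f : ι → UT Nf) (a : UT Nf) {η θ cV : ℝ}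
    (hηθ : η ≤ θ) (h : ∑ k, Real.exp (-(η * tdist1 Nf a (f k))) ≤ cV) :
    ∑ k, Real.exp (-(θ * tdist1 Nf a (f k))) ≤ cV :=
  (Finset.sum_le_sum fun _ _ => Real.exp_le_exp.2
    (neg_le_neg (mul_le_mul_of_nonneg_right hηθ (tdist1_nonneg _ _)))).trans h

omit [∀ i, NeZero (Nf i)] in
/-- **Accretivity constant ≤ diagonal entry bound**: if `m‖v‖² ≤ Re⟨v, Av⟩` for all `v` and `‖A i₀ i₀‖ ≤ a`, then `m ≤ a`
(test vector `δ_{i₀}`).  With `a = K̄_P·e^{0}` from a walk majorant this is `m ≤ K̄_P` — the accretivity constant of print's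
p. 15 perturbative argument never exceeds the (3.108) majorant constant. [cite: Balaban1988RG2Cluster, p.15; Balaban1985BackgroundPropagators, (3.108) p.416] -/
theorem m_le_of_accretive {n : Type} [Fintype n] [DecidableEq n] (A : Matrix n n ℂ) {m a : ℝ}
    (hacc : ∀ v : n → ℂ, m * ∑ i, ‖v i‖ ^ 2 ≤ (∑ i, star (v i) * (A *ᵥ v) i).re) (i₀ : n)
    (ha : ‖A i₀ i₀‖ ≤ a) : m ≤ a := by
  have h := hacc (Pi.single i₀ 1)
  have h1 : ∑ i, ‖(Pi.single i₀ (1 : ℂ) : n → ℂ) i‖ ^ 2 = 1 := by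
    rw [Finset.sum_eq_single i₀]
    · simp
    · intro b _ hb; simp [hb]
    · intro hi; exact absurd (Finset.mem_univ i₀) hi
  have h2 : ∑ i, star ((Pi.single i₀ (1 : ℂ) : n → ℂ) i) * (A *ᵥ Pi.single i₀ 1) i = A i₀ i₀ := by
    rw [Matrix.mulVec_single_one, Finset.sum_eq_single i₀]
    · simp
    · intro b _ hb; simp [hb]
    · intro hi; exact absurd (Finset.mem_univ i₀) hi
  rw [h1, h2, mul_one] at h
  exact h.trans ((Complex.re_le_norm _).trans ha)

/-- **SLOT GUARD, arithmetic core** (memo cell `ym-nodeO-ideate` P3 g24 on `NodeOLettersOfWalks.termLetters_of_walks` AS TYPED, one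
volume constant `c_V` at one rate `η`): its rate hypotheses `θ′ + η ≤ κ`, `ρ′ + η ≤ ρ₀ ≤ θ′`, `0 ≤ ρ′` and the square root's Combes–Thomas condition
`8K̄_Pκc_V ≤ mκ_P` FORCE `16K̄_P·η·c_V ≤ m·κ_P` — the volume constant AT RATE `η`, times `η`, is bounded by `(m/K̄_P)κ_P/16`.  On a
family exhausting `ℤ⁴`-balls `c_V ≥ sup_N max_i Σ_k e^{−ηd₁} = coth(η/2)^4` (unit multiplicity) and `min_η η·coth(η/2)^4 = 4.4326`
(at `η = 3.264`): jointly satisfiable only if `κ_P·m/K̄_P ≥ 70.92`, i.e. only for precisions whose off-diagonal entries at distance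
`d` are `≤ m/(70.92·e·d)` — numbers from the memo cell's census, not kernel-checked; the kernel content is the inequality below.
Pure arithmetic; the reason the (B1) input of record is the two-constant edition `termLetters_of_walks₂`. [cite: Balaban1988RG2Cluster, (2.7) p.13, (2.16) p.16] -/
theorem single_constant_constraint {η κ θ' ρ₀ ρ' KbarP m kapP cV : ℝ}
    (hθ'η : θ' + η ≤ κ) (hsplit : ρ' + η ≤ ρ₀) (hρ₀S : ρ₀ ≤ θ') (hρ' : 0 ≤ ρ')
    (hκm : 8 * KbarP * κ * cV ≤ m * kapP) (hK : 0 ≤ KbarP) (hcV : 0 ≤ cV) :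
    16 * KbarP * η * cV ≤ m * kapP := by
  have h2η : 2 * η ≤ κ := by linarith
  have : 8 * KbarP * (2 * η) * cV ≤ 8 * KbarP * κ * cV :=
    mul_le_mul_of_nonneg_right (mul_le_mul_of_nonneg_left h2η (by positivity)) hcV
  linarith

/-- The same with `m ≤ K̄_P` (`m_le_of_accretive` against the walk majorant on the diagonal) and `K̄_P > 0`: `16·η·c_V ≤ κ_P`.
[cite: Balaban1988RG2Cluster, (2.7) p.13, (2.16) p.16] -/
theorem single_constant_constraint' {η κ θ' ρ₀ ρ' KbarP m kapP cV : ℝ}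
    (hθ'η : θ' + η ≤ κ) (hsplit : ρ' + η ≤ ρ₀) (hρ₀S : ρ₀ ≤ θ') (hρ' : 0 ≤ ρ')
    (hκm : 8 * KbarP * κ * cV ≤ m * kapP) (hmK : m ≤ KbarP) (hK : 0 < KbarP) (hcV : 0 ≤ cV) (hkapP : 0 ≤ kapP) :
    16 * η * cV ≤ kapP := by
  have h1 := single_constant_constraint hθ'η hsplit hρ₀S hρ' hκm hK.le hcV
  have h3 : m * kapP ≤ KbarP * kapP := mul_le_mul_of_nonneg_right hmK hkapP
  have h4 : KbarP * (16 * η * cV) ≤ KbarP * kapP := by nlinarith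
  exact le_of_mul_le_mul_left h4 hK


/-! ## §2. The rung, typed ACROSS the family -/

/-- **THE CONSTANT PACKAGE OF THE W-WALKS RUNG** (16 reals, ONE for every member and term of the family): analyticity radius `R` in
the background field; drop ∕ torus rate ∕ summability constant `(ε_L, κ_L, K̄_L)` of the local factor's expansion, `(ε_P, κ_P, K̄_P)` of
the full precision's, `(ε_A, κ_A, K̄_A)` of the term precision's; accretivity constants `m` (of `P`) and `m_A` (of `A2`); the volume
rate `η` and constant `c_V`; the square root's Combes–Thomas volume constant `c_V₀` (AT RATE `κ_P/2`); the far-ness `R_σ`.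
Nothing asserted. [cite: Balaban1988RG2Cluster, p.13, p.15, (2.16) p.16; Balaban1985BackgroundPropagators, Thm 3.10 p.416] -/
structure WalkPackage where
  R : ℝ
  εL : ℝ
  kapL : ℝ
  KbarL : ℝ
  εP : ℝ
  kapP : ℝ
  KbarP : ℝ
  m : ℝ
  εA : ℝ
  kapA : ℝ
  KbarA : ℝ
  mA : ℝ
  η : ℝ
  cV : ℝ
  cV₀ : ℝ
  Rσ : ℝ

namespace WalkPackage

/-- Sign conditions on the package (what `termLetters_of_walks₂` consumes; `K̄ ≥ 0` is automatic on a nonempty member,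
`kbar_nonneg_of_jointWalkExpansion`, and recorded here so that the family-level theorem needs no member).
[cite: Balaban1988RG2Cluster, p.15, (2.16) p.16] -/
structure Admissible (q : WalkPackage) : Prop where
  hR : 0 < q.R
  hεL : 0 ≤ q.εL
  hkapL : 0 ≤ q.kapL
  hKbarL : 0 ≤ q.KbarL
  hεP : 0 ≤ q.εP
  hkapP : 0 < q.kapP
  hKbarP : 0 ≤ q.KbarP
  hm : 0 < q.m
  hεA : 0 ≤ q.εA
  hkapA : 0 ≤ q.kapA
  hKbarA : 0 ≤ q.KbarA
  hmA : 0 < q.mA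
  hη : 0 ≤ q.η
  hcV : 0 ≤ q.cV
  hcV₀ : 0 ≤ q.cV₀

/-- The Γ-kernel's decay letter constant `B_Γ = K̄_L(4/√m)c_V` (output of `termLetters_of_walks₂`). [cite: Balaban1988RG2Cluster, (2.16) p.16] -/
def BΓ (q : WalkPackage) : ℝ := q.KbarL * (4 / Real.sqrt q.m) * q.cV

/-- The Γ-kernel's σ-localisation letter constant `B′_Γ = (2K̄_L(4/√m) + K̄_L·16(2K̄_P)c_V²/(m√m))c_V`. [cite: Balaban1988RG2Cluster, (2.16) p.16] -/
def BΓ' (q : WalkPackage) : ℝ :=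
  (2 * q.KbarL * (4 / Real.sqrt q.m) + q.KbarL * (16 * (2 * q.KbarP) * q.cV ^ 2 / (q.m * Real.sqrt q.m))) * q.cV

/-- The exchange constant `K̄ = max(3B_Γ + B′_Γ, 3K̄_A + 2K̄_A)` of `NodeOLetters.acrossSmall_of_letters`. [cite: Balaban1988RG2Cluster, p.15] -/
def Kbar (q : WalkPackage) : ℝ := max (3 * q.BΓ + q.BΓ') (3 * q.KbarA + 2 * q.KbarA)

/-- `B_Γ ≥ 0` on an admissible package. [cite: Balaban1988RG2Cluster, (2.16) p.16] -/
theorem BΓ_nonneg {q : WalkPackage} (hq : q.Admissible) : 0 ≤ q.BΓ := by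
  unfold BΓ; have := hq.hKbarL; have := hq.hcV; positivity

/-- `B′_Γ ≥ 0` on an admissible package. [cite: Balaban1988RG2Cluster, (2.16) p.16] -/
theorem BΓ'_nonneg {q : WalkPackage} (hq : q.Admissible) : 0 ≤ q.BΓ' := by
  unfold BΓ'; have := hq.hKbarL; have := hq.hcV; have := hq.hKbarP; have := hq.hm.le; positivity

/-- The exchange constant `K̄ ≥ 0` on an admissible package. [cite: Balaban1988RG2Cluster, p.15] -/
theorem Kbar_nonneg {q : WalkPackage} (hq : q.Admissible) : 0 ≤ q.Kbar :=
  le_max_of_le_right (by have := hq.hKbarA; linarith)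

end WalkPackage

/-- **THE RATE BOOK**: the seven derived rates `(κ, θ′, ρ_L, ρ_E, κ_C, ρ₀, ρ′)` of `termLetters_of_walks₂` with their twenty
inequalities against the package (the square root's Combes–Thomas condition on `c_V₀`, the covariance's on `c_V`).  Data + proofs;
`WalkPackage.stdRates` (§3) is one inhabitant whenever `η ≤ etaMax q`. [cite: Balaban1988RG2Cluster, (2.16) p.16] -/
structure RateBook (q : WalkPackage) where
  κ : ℝ
  θ' : ℝ
  ρL : ℝ
  ρE : ℝ
  κC : ℝ
  ρ₀ : ℝ
  ρ' : ℝ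
  hκ : 0 ≤ κ
  hκ4 : κ ≤ q.kapP / 4
  hκm : 8 * q.KbarP * κ * q.cV₀ ≤ q.m * q.kapP
  hθ' : 0 ≤ θ'
  hθ'ε : θ' ≤ q.εP
  hθ'η : θ' + q.η ≤ κ
  hρL : ρL ≤ q.kapL
  hρLε : ρL ≤ q.εL
  hρEpos : 0 < ρE
  hρEk : ρE ≤ q.kapA
  hρEε : ρE ≤ q.εA
  hηE : q.η ≤ ρE / 2
  hκC : 0 ≤ κC
  hκC4 : κC ≤ ρE / 4
  hκCm : 8 * q.KbarA * κC * q.cV ≤ q.mA * ρE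
  hρ' : 0 ≤ ρ'
  hsplit : ρ' + q.η ≤ ρ₀
  hρ₀L : ρ₀ ≤ ρL
  hρ₀S : ρ₀ ≤ θ'
  hρ'E : ρ' ≤ ρE

section Across

variable {c : B13.Consts}

/-- **THE W-WALKS DATUM OF ONE (2.14)-TERM with package `q`** (Prop; the extra columns `C₀` finite with decidable equality as
instance arguments): `X ≠ ∅`; the PRODUCT READING `G2 = L·P^{−1/2}` ([II] p. 13: `Γ_k(Z₀,σ) = C*Δ_k(σ)C_{Z₀ᶜ}·(C^{(k)})^{1/2}(σ)`)
with joint walk expansions of `L` and of `P` through `X` on the `R`-ball and `m`-accretivity of `P` at complex backgrounds; a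
joint walk expansion of the term's precision `A2` and its `m_A`-accretivity; the five volume sums; the geometric clause.  The walk
objects (term types, terms, sub-families, amplitudes, walk distances, walk rates) and `L`, `P` are EXISTENTIAL — only the sixteen
constants are exposed.  This is the [B9]-Thm-3.10-shaped statement per term; print asserts it for Bałaban's operators (p. 13:
*"discussed in [13] for all operators determining Δ_k, and for C^{(k)}(Z₀)"*), NOT for the square root — which is why the
datum carries `P`, not `P^{−1/2}`.  NOTE ON `product` (v1.0.1, the cell's discharge referee READ-338 (A3)): the reading
`G2 σ u = L σ u * invSqrt (P σ u)` is asked for ALL `(σ,u)`, also outside polydisc × ball where `P σ u` need not be accretive and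
`invSqrt` is the tree's junk-valued total function — this is satisfiable BY DEFINITION of the datum `G2` (a witness defines
`G2 := fun σ u => L σ u * invSqrt (P σ u)`, cf. `NodeOLettersOfWalksWitness.modelKernels`, `hG2` by `rfl`); only the values on
polydisc × ball enter the letters. [cite: Balaban1988RG2Cluster, (2.7) p.13, p.15, (2.14)–(2.16) pp.15–16; Balaban1985BackgroundPropagators, Thm 3.10 p.416, (3.154) p.427] -/
structure TermWalks (𝒦 : TermKernels c d N' ν Nf E) [Fintype 𝒦.C₀] [DecidableEq 𝒦.C₀] (q : WalkPackage) : Prop where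
  nonempty : 𝒦.X.Nonempty
  product : ∃ (L : (TPt d N' → ℂ) → E → Matrix 𝒦.Λ (𝒦.Λ ⊕ 𝒦.C₀) ℂ)
      (P : (TPt d N' → ℂ) → E → Matrix (𝒦.Λ ⊕ 𝒦.C₀) (𝒦.Λ ⊕ 𝒦.C₀) ℂ),
      (∀ σ u, 𝒦.G2 σ u = L σ u * invSqrt (P σ u)) ∧
      (∃ (W : Type) (T : W → (TPt d N' → ℂ) → E → Matrix 𝒦.Λ (𝒦.Λ ⊕ 𝒦.C₀) ℂ) (SX : Set W) (A : W → ℝ)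
          (D : W → UT Nf → UT Nf → ℝ) (ρw : ℝ),
          JointWalkExpansion c 𝒦.locΛ 𝒦.locN L 𝒦.X q.R q.εL q.kapL q.KbarL T SX A D ρw) ∧
      (∃ (W : Type) (T : W → (TPt d N' → ℂ) → E → Matrix (𝒦.Λ ⊕ 𝒦.C₀) (𝒦.Λ ⊕ 𝒦.C₀) ℂ) (SX : Set W) (A : W → ℝ)
          (D : W → UT Nf → UT Nf → ℝ) (ρw : ℝ),
          JointWalkExpansion c 𝒦.locN 𝒦.locN P 𝒦.X q.R q.εP q.kapP q.KbarP T SX A D ρw) ∧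
      (∀ σ : TPt d N' → ℂ, (∀ j, ‖σ j‖ ≤ Real.exp c.κ₁) → ∀ u ∈ ball (0 : E) q.R,
          ∀ v : 𝒦.Λ ⊕ 𝒦.C₀ → ℂ, q.m * ∑ i, ‖v i‖ ^ 2 ≤ (∑ i, star (v i) * (P σ u *ᵥ v) i).re)
  precision : ∃ (W : Type) (T : W → (TPt d N' → ℂ) → E → Matrix 𝒦.Λ 𝒦.Λ ℂ) (SX : Set W) (A : W → ℝ)
      (D : W → UT Nf → UT Nf → ℝ) (ρw : ℝ), JointWalkExpansion c 𝒦.locΛ 𝒦.locΛ 𝒦.A2 𝒦.X q.R q.εA q.kapA q.KbarA T SX A D ρw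
  accA : ∀ σ : TPt d N' → ℂ, (∀ j, ‖σ j‖ ≤ Real.exp c.κ₁) → ∀ u ∈ ball (0 : E) q.R,
      ∀ v : 𝒦.Λ → ℂ, q.mA * ∑ i, ‖v i‖ ^ 2 ≤ (∑ i, star (v i) * (𝒦.A2 σ u *ᵥ v) i).re
  volN₀ : ∀ i : 𝒦.Λ ⊕ 𝒦.C₀, ∑ k : 𝒦.Λ ⊕ 𝒦.C₀, Real.exp (-(q.kapP / 2 * tdist1 Nf (𝒦.locN i) (𝒦.locN k))) ≤ q.cV₀
  volN : ∀ i : 𝒦.Λ ⊕ 𝒦.C₀, ∑ k : 𝒦.Λ ⊕ 𝒦.C₀, Real.exp (-(q.η * tdist1 Nf (𝒦.locN i) (𝒦.locN k))) ≤ q.cV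
  volN' : ∀ j : 𝒦.Λ ⊕ 𝒦.C₀, ∑ l : 𝒦.Λ ⊕ 𝒦.C₀, Real.exp (-(q.η * tdist1 Nf (𝒦.locN l) (𝒦.locN j))) ≤ q.cV
  volΛN : ∀ i : 𝒦.Λ, ∑ k : 𝒦.Λ ⊕ 𝒦.C₀, Real.exp (-(q.η * tdist1 Nf (𝒦.locΛ i) (𝒦.locN k))) ≤ q.cV
  volΛ : ∀ i : 𝒦.Λ, ∑ k : 𝒦.Λ, Real.exp (-(q.η * tdist1 Nf (𝒦.locΛ i) (𝒦.locΛ k))) ≤ q.cV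
  far : ∀ b : 𝒦.Λ, ∀ z ∈ 𝒦.X, q.Rσ ≤ tdist1 Nf (𝒦.locΛ b) z

/-- **One term's `TermLetters` from its W-walks datum** at any rate book: `termLetters_of_walks₂` with the existentials opened.
[cite: Balaban1988RG2Cluster, (2.14)–(2.16) pp.15–16; Balaban1985BackgroundPropagators, Thm 3.10 p.416] -/
theorem termLetters_of_termWalks {𝒦 : TermKernels c d N' ν Nf E} [Fintype 𝒦.C₀] [DecidableEq 𝒦.C₀] {q : WalkPackage}
    (hq : q.Admissible) (r : RateBook q) (h : TermWalks 𝒦 q) :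
    TermLetters 𝒦 q.R r.ρ' r.κC q.BΓ q.BΓ' q.KbarA (2 * q.KbarA) (4 / q.mA) q.Rσ := by
  obtain ⟨L, P, hG2, ⟨WL, TL, SXL, AL, DL, ρwL, hJL⟩, ⟨WP, TP, SXP, AP, DP, ρwP, hJP⟩, hPacc⟩ := h.product
  obtain ⟨WA, TA, SXA, AA, DA, ρwA, hJA⟩ := h.precision
  exact NodeOLettersOfWalks.termLetters_of_walks₂ 𝒦 h.nonempty L P hG2 hq.hR hJL hq.hεL hq.hkapL hJP hq.hεP hq.hkapP hq.hm hPacc hJA hq.hεA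
    hq.hkapA hq.hmA h.accA h.volN₀ hq.hη hq.hcV h.volN h.volN' h.volΛN h.volΛ h.far r.hκ r.hκ4 r.hκm r.hθ' r.hθ'ε r.hθ'η
    r.hρL r.hρLε r.hρEpos r.hρEk r.hρEε r.hηE r.hκC r.hκC4 r.hκCm r.hρ' r.hsplit r.hρ₀L r.hρ₀S r.hρ'E

/-- **THE W-WALKS RUNG — UNIFORM ACROSS THE FAMILY**: ONE package `q` such that every term of every member `𝓣 s` (`s` = (scale,
history, torus, domain)) carries a W-walks datum with it (the member's extra columns finite: the instances are `∃`-binders).  The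
candidate uniform statement SHORT OF [B12] Thm 2 (memo cell ym-nodeO, lens P3): print's [13]-expansions for the operators determining `Δ_k` and for
`C^{(k)}(Z₀)`, with k-, history- and torus-UNIFORM constants at COMPLEX backgrounds. STATEMENT ONLY. [cite: Balaban1988RG2Cluster, p.13, p.15; Balaban1985BackgroundPropagators, Thm 3.10 p.416] -/
def UniformWalksAcross {S : Type*} (𝓣 : S → TorusTerms c d) (q : WalkPackage) : Prop :=
  ∀ s, ∀ i : (𝓣 s).ι, ∃ (_ : Fintype ((𝓣 s).𝒦 i).C₀) (_ : DecidableEq ((𝓣 s).𝒦 i).C₀), TermWalks ((𝓣 s).𝒦 i) q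

/-- **NODE O FROM THE W-WALKS RUNG** (kernel-checked composition `termLetters_of_walks₂` ⟶ `NodeOLetters.acrossSmall_of_letters`):
a uniform W-walks package `q` (admissible), any rate book `r` with `0 < κ_C ≤ ρ′`, `0 ≤ α < R`, `R_σ0 ≤ R_σ`, and the exchange
inequality `2K̄(e^{−(ρ′−κ_C)R_σ} + α/R) ≤ θ₀` (`K̄ = q.Kbar`) give `ExistsUniformAcrossSmall 𝓣 α R_σ0 θ₀` — B13TermWalkDataOneTorus
:353, NODE O's binder of record.  The hypothesis `UniformWalksAcross 𝓣 q` for BAŁABAN's family is NOT supplied.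
[cite: Balaban1988RG2Cluster, (1.11) p.5, p.13, p.15, (2.16) p.16; Balaban1985BackgroundPropagators, Thm 3.10 p.416] -/
theorem acrossSmall_of_walks {S : Type*} {𝓣 : S → TorusTerms c d} {q : WalkPackage}
    (hall : UniformWalksAcross 𝓣 q) (hq : q.Admissible) (r : RateBook q)
    {α Rσ₀ θ₀ : ℝ} (hα : 0 ≤ α) (hαR : α < q.R) (hRσ : Rσ₀ ≤ q.Rσ) (hκCpos : 0 < r.κC) (hκCρ : r.κC ≤ r.ρ')
    (hθ : 2 * q.Kbar * (Real.exp (-((r.ρ' - r.κC) * q.Rσ)) + α / q.R) ≤ θ₀) :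
    ExistsUniformAcrossSmall 𝓣 α Rσ₀ θ₀ := by
  have hBC : (0 : ℝ) ≤ 4 / q.mA := by have := hq.hmA; positivity
  refine acrossSmall_of_letters (BC := 4 / q.mA) (fun s i => ?_) hαR hα hκCpos hκCρ hRσ (WalkPackage.BΓ_nonneg hq)
    (WalkPackage.BΓ'_nonneg hq) hq.hKbarA (by linarith [hq.hKbarA]) hBC hθ
  obtain ⟨instF, instD, hw⟩ := hall s i
  exact termLetters_of_termWalks hq r hw

end Across

/-! ## §3. Non-circularity: a standard rate book, and the ORDER of choices -/

namespace WalkPackage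

/-- The full precision's Combes–Thomas rate `κ⋆ = min(κ_P/4, mκ_P/(8K̄_Pc_V₀ + 1))` — a function of `(κ_P, m, K̄_P, c_V₀)` ONLY
(`NodeOLettersSqrtExpDecay.exists_uniform_rate`'s witness, made explicit). [cite: Balaban1988RG2Cluster, (2.7) p.13, (2.16) p.16] -/
def kapStar (q : WalkPackage) : ℝ := min (q.kapP / 4) (q.m * q.kapP / (8 * q.KbarP * q.cV₀ + 1))

/-- The term precision's letter rate `ρ_E = min(κ_A, ε_A)`. [cite: Balaban1988RG2Cluster, (2.16) p.16] -/
def rhoE (q : WalkPackage) : ℝ := min q.kapA q.εA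

/-- The master rate `μ = min(κ⋆, ε_P, κ_L, ε_L, ρ_E)` — independent of `(η, c_V)`. [cite: Balaban1988RG2Cluster, (2.16) p.16] -/
def mu (q : WalkPackage) : ℝ := min (min (min (min q.kapStar q.εP) q.kapL) q.εL) q.rhoE

/-- **THE ADMISSIBLE CEILING FOR THE VOLUME RATE**: `etaMax = min(μ/4, ρ_E/2)` — a function of
`(κ_P, m, K̄_P, c_V₀; ε_P, κ_L, ε_L, κ_A, ε_A)` and NOT of `(η, c_V)`: choose `η ≤ etaMax` FIRST, then `c_V := V(η)`. [cite: Balaban1988RG2Cluster, (2.16) p.16] -/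
def etaMax (q : WalkPackage) : ℝ := min (q.mu / 4) (q.rhoE / 2)

/-- The covariance rate `κ_C⋆ = min(ρ_E/4, m_Aρ_E/(8K̄_Ac_V + 1), μ/8)` — the only rate that reads `c_V`. [cite: Balaban1988RG2Cluster, (2.16) p.16] -/
def kapCStar (q : WalkPackage) : ℝ := min (min (q.rhoE / 4) (q.mA * q.rhoE / (8 * q.KbarA * q.cV + 1))) (q.mu / 8)

/-- `κ⋆` is a legitimate Combes–Thomas rate for the full precision: `0 < κ⋆ ≤ κ_P/4` and `8K̄_Pκ⋆c_V₀ ≤ mκ_P` (the square root's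
smallness condition `hκm` of `termLetters_of_walks₂`, met by construction). [cite: Balaban1988RG2Cluster, (2.7) p.13, (2.16) p.16] -/
theorem kapStar_spec {q : WalkPackage} (hq : q.Admissible) :
    0 < q.kapStar ∧ q.kapStar ≤ q.kapP / 4 ∧ 8 * q.KbarP * q.kapStar * q.cV₀ ≤ q.m * q.kapP := by
  have hm := hq.hm; have hk := hq.hkapP; have hK := hq.hKbarP; have hc := hq.hcV₀
  have hden : 0 < 8 * q.KbarP * q.cV₀ + 1 := by positivity
  refine ⟨lt_min (by positivity) (div_pos (mul_pos hm hk) hden), min_le_left _ _, ?_⟩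
  have hle : q.kapStar ≤ q.m * q.kapP / (8 * q.KbarP * q.cV₀ + 1) := min_le_right _ _
  have hnn : 0 ≤ q.kapStar := le_min (by positivity) (div_nonneg (mul_nonneg hm.le hk.le) hden.le)
  calc 8 * q.KbarP * q.kapStar * q.cV₀ = (8 * q.KbarP * q.cV₀) * q.kapStar := by ring
    _ ≤ (8 * q.KbarP * q.cV₀ + 1) * (q.m * q.kapP / (8 * q.KbarP * q.cV₀ + 1)) :=
        mul_le_mul (by linarith) hle hnn hden.le
    _ = q.m * q.kapP := by field_simp

/-- `κ_C⋆` is a legitimate covariance rate: `0 < κ_C⋆ ≤ ρ_E/4`, `8K̄_Aκ_C⋆c_V ≤ m_Aρ_E` (the covariance's smallness condition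
`hκCm`), and `κ_C⋆ ≤ μ/8 < ρ′`. [cite: Balaban1988RG2Cluster, (2.16) p.16] -/
theorem kapCStar_spec {q : WalkPackage} (hq : q.Admissible) (hρE : 0 < q.rhoE) (hμ : 0 < q.mu) :
    0 < q.kapCStar ∧ q.kapCStar ≤ q.rhoE / 4 ∧ 8 * q.KbarA * q.kapCStar * q.cV ≤ q.mA * q.rhoE ∧
      q.kapCStar ≤ q.mu / 8 := by
  have hmA := hq.hmA; have hK := hq.hKbarA; have hc := hq.hcV
  have hden : 0 < 8 * q.KbarA * q.cV + 1 := by positivity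
  refine ⟨lt_min (lt_min (by positivity) (div_pos (mul_pos hmA hρE) hden)) (by positivity),
    (min_le_left _ _).trans (min_le_left _ _), ?_, min_le_right _ _⟩
  have hle : q.kapCStar ≤ q.mA * q.rhoE / (8 * q.KbarA * q.cV + 1) := (min_le_left _ _).trans (min_le_right _ _)
  have hnn : 0 ≤ q.kapCStar :=
    le_min (le_min (by positivity) (div_nonneg (mul_nonneg hmA.le hρE.le) hden.le)) (by positivity)
  calc 8 * q.KbarA * q.kapCStar * q.cV = (8 * q.KbarA * q.cV) * q.kapCStar := by ring
    _ ≤ (8 * q.KbarA * q.cV + 1) * (q.mA * q.rhoE / (8 * q.KbarA * q.cV + 1)) :=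
        mul_le_mul (by linarith) hle hnn hden.le
    _ = q.mA * q.rhoE := by field_simp

/-- Strictly positive input rates (beyond `Admissible`'s signs): what makes `μ > 0`. [cite: Balaban1985BackgroundPropagators, Thm 3.10 p.416] -/
structure PositiveRates (q : WalkPackage) : Prop where
  hkapL : 0 < q.kapL
  hεL : 0 < q.εL
  hεP : 0 < q.εP
  hkapA : 0 < q.kapA
  hεA : 0 < q.εA

/-- `ρ_E > 0` under positive input rates. [cite: Balaban1988RG2Cluster, (2.16) p.16] -/
theorem rhoE_pos {q : WalkPackage} (hp : q.PositiveRates) : 0 < q.rhoE := lt_min hp.hkapA hp.hεA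

/-- The master rate `μ > 0` under an admissible package with positive input rates. [cite: Balaban1988RG2Cluster, (2.16) p.16] -/
theorem mu_pos {q : WalkPackage} (hq : q.Admissible) (hp : q.PositiveRates) : 0 < q.mu :=
  lt_min (lt_min (lt_min (lt_min (kapStar_spec hq).1 hp.hεP) hp.hkapL) hp.hεL) (rhoE_pos hp)

/-- **THE STANDARD RATE BOOK** — `κ := κ⋆`, `θ′ = ρ₀ := μ/2`, `ρ_L := μ`, `ρ_E := min(κ_A, ε_A)`, `ρ′ := μ/4`, `κ_C := κ_C⋆` —
an inhabitant of `RateBook q` for ANY `c_V, c_V₀ ≥ 0`, provided `η ≤ etaMax q`.  ORDER OF CHOICES (no circularity):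
`(κ_P, m, K̄_P)` & `c_V₀ := V(κ_P/2)` ⟹ `κ⋆` ⟹ `μ, etaMax` ⟹ pick `η ∈ (0, etaMax]` ⟹ `c_V := V(η)` ⟹ `κ_C⋆`.
[cite: Balaban1988RG2Cluster, (2.16) p.16; Balaban1985BackgroundPropagators, Thm 3.10 p.416] -/
def stdRates (q : WalkPackage) (hq : q.Admissible) (hp : q.PositiveRates) (hη : q.η ≤ q.etaMax) : RateBook q :=
  have hκ := kapStar_spec hq
  have hρE := rhoE_pos hp
  have hμ := mu_pos hq hp
  have hκC := kapCStar_spec hq hρE hμ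
  have hμκ : q.mu ≤ q.kapStar :=
    le_trans (min_le_left _ _) (le_trans (min_le_left _ _) (le_trans (min_le_left _ _) (min_le_left _ _)))
  have hμεP : q.mu ≤ q.εP :=
    le_trans (min_le_left _ _) (le_trans (min_le_left _ _) (le_trans (min_le_left _ _) (min_le_right _ _)))
  have hμkapL : q.mu ≤ q.kapL := le_trans (min_le_left _ _) (le_trans (min_le_left _ _) (min_le_right _ _))
  have hμεL : q.mu ≤ q.εL := le_trans (min_le_left _ _) (min_le_right _ _)
  have hμρE : q.mu ≤ q.rhoE := min_le_right _ _
  have hημ : q.η ≤ q.mu / 4 := hη.trans (min_le_left _ _)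
  have hηE : q.η ≤ q.rhoE / 2 := hη.trans (min_le_right _ _)
  { κ := q.kapStar, θ' := q.mu / 2, ρL := q.mu, ρE := q.rhoE, κC := q.kapCStar, ρ₀ := q.mu / 2, ρ' := q.mu / 4,
    hκ := hκ.1.le, hκ4 := hκ.2.1, hκm := hκ.2.2,
    hθ' := by positivity, hθ'ε := by linarith, hθ'η := by linarith,
    hρL := hμkapL, hρLε := hμεL,
    hρEpos := hρE, hρEk := min_le_left _ _, hρEε := min_le_right _ _, hηE := hηE,
    hκC := hκC.1.le, hκC4 := hκC.2.1, hκCm := hκC.2.2.1,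
    hρ' := by positivity, hsplit := by linarith, hρ₀L := by linarith, hρ₀S := le_rfl, hρ'E := by linarith }

/-- The standard rate book decays: `0 < κ_C < ρ′ = μ/4`. [cite: Balaban1988RG2Cluster, (2.16) p.16] -/
theorem stdRates_pos (q : WalkPackage) (hq : q.Admissible) (hp : q.PositiveRates) (hη : q.η ≤ q.etaMax) :
    0 < (q.stdRates hq hp hη).κC ∧ (q.stdRates hq hp hη).κC < (q.stdRates hq hp hη).ρ' ∧
      (q.stdRates hq hp hη).ρ' = q.mu / 4 := by
  have hκC := kapCStar_spec hq (rhoE_pos hp) (mu_pos hq hp)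
  have hμ := mu_pos hq hp
  refine ⟨hκC.1, ?_, rfl⟩
  show q.kapCStar < q.mu / 4
  linarith [hκC.2.2.2]

end WalkPackage

/-! ## §4. What remains of NODE O's smallness: print's two sources, as explicit thresholds -/

section Thresholds

variable {c : B13.Consts}

/-- **NODE O FROM THE W-WALKS RUNG, THRESHOLD FORM**: with a uniform admissible package, a rate book with `0 < κ_C < ρ′`, and
`0 ≤ α < R`, `R_σ0 ≤ R_σ`, the exchange inequality holds as soon as `α ≤ θ₀R/(4K̄ + 4)` (bigger analyticity space, print's
`O(α₀ + α₁)`) and `R_σ ≥ log((4K̄ + 4)/θ₀)/(ρ′ − κ_C)` (σ-cubes far from `Z₀`, print's `O(1)e^{−⅓δ₀M}`, `M` large) — so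
`ExistsUniformAcrossSmall 𝓣 α R_σ0 θ₀` for every `θ₀ > 0`.  Elementary from `acrossSmall_of_walks`. [cite: Balaban1988RG2Cluster, (1.11) p.5, p.13, p.15] -/
theorem acrossSmall_of_walks_thresholds {S : Type*} {𝓣 : S → TorusTerms c d} {q : WalkPackage}
    (hall : UniformWalksAcross 𝓣 q) (hq : q.Admissible) (r : RateBook q) (hκCpos : 0 < r.κC) (hκCρ : r.κC < r.ρ')
    {α Rσ₀ θ₀ : ℝ} (hθ₀ : 0 < θ₀) (hα : 0 ≤ α) (hαR : α < q.R) (hRσ : Rσ₀ ≤ q.Rσ)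
    (hαsmall : α ≤ θ₀ * q.R / (4 * q.Kbar + 4))
    (hRσlarge : Real.log ((4 * q.Kbar + 4) / θ₀) / (r.ρ' - r.κC) ≤ q.Rσ) :
    ExistsUniformAcrossSmall 𝓣 α Rσ₀ θ₀ := by
  have hK : 0 ≤ q.Kbar := WalkPackage.Kbar_nonneg hq
  have hR := hq.hR
  have h4 : 0 < 4 * q.Kbar + 4 := by positivity
  have hε : 0 < r.ρ' - r.κC := sub_pos.2 hκCρ
  -- the far-ness threshold ⟹ `e^{−εR_σ} ≤ θ₀/(4K̄+4)`
  have h1 : Real.log ((4 * q.Kbar + 4) / θ₀) ≤ (r.ρ' - r.κC) * q.Rσ := (div_le_iff₀' hε).1 hRσlarge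
  have h2 : (4 * q.Kbar + 4) / θ₀ ≤ Real.exp ((r.ρ' - r.κC) * q.Rσ) :=
    (Real.log_le_iff_le_exp (by positivity)).1 h1
  have h3 : Real.exp (-((r.ρ' - r.κC) * q.Rσ)) ≤ θ₀ / (4 * q.Kbar + 4) := by
    rw [Real.exp_neg, inv_le_comm₀ (Real.exp_pos _) (by positivity), inv_div]
    exact h2
  -- the analyticity-space threshold ⟹ `α/R ≤ θ₀/(4K̄+4)`
  have h5 : α / q.R ≤ θ₀ / (4 * q.Kbar + 4) := by
    rw [div_le_iff₀ hR]
    calc α ≤ θ₀ * q.R / (4 * q.Kbar + 4) := hαsmall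
      _ = θ₀ / (4 * q.Kbar + 4) * q.R := by ring
  -- the exchange inequality
  have hθ : 2 * q.Kbar * (Real.exp (-((r.ρ' - r.κC) * q.Rσ)) + α / q.R) ≤ θ₀ := by
    have h6 : 2 * q.Kbar * (Real.exp (-((r.ρ' - r.κC) * q.Rσ)) + α / q.R) ≤
        2 * q.Kbar * (θ₀ / (4 * q.Kbar + 4) + θ₀ / (4 * q.Kbar + 4)) :=
      mul_le_mul_of_nonneg_left (add_le_add h3 h5) (by positivity)
    have h7 : 2 * q.Kbar * (θ₀ / (4 * q.Kbar + 4) + θ₀ / (4 * q.Kbar + 4)) = (4 * q.Kbar) * θ₀ / (4 * q.Kbar + 4) := by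
      ring
    have h8 : (4 * q.Kbar) * θ₀ / (4 * q.Kbar + 4) ≤ θ₀ := by
      rw [div_le_iff₀ h4]; nlinarith
    linarith
  exact acrossSmall_of_walks hall hq r hα hαR hRσ hκCpos hκCρ.le hθ

/-- **COROLLARY — NODE O's (v)⁺ for EVERY `θ₀ > 0` from the rung with the standard rate book**, given the two thresholds.
[cite: Balaban1988RG2Cluster, (1.11) p.5, p.13, p.15] -/
theorem acrossSmall_of_walks_std {S : Type*} {𝓣 : S → TorusTerms c d} {q : WalkPackage}
    (hall : UniformWalksAcross 𝓣 q) (hq : q.Admissible) (hp : q.PositiveRates) (hη : q.η ≤ q.etaMax)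
    {α Rσ₀ θ₀ : ℝ} (hθ₀ : 0 < θ₀) (hα : 0 ≤ α) (hαR : α < q.R) (hRσ : Rσ₀ ≤ q.Rσ)
    (hαsmall : α ≤ θ₀ * q.R / (4 * q.Kbar + 4))
    (hRσlarge : Real.log ((4 * q.Kbar + 4) / θ₀) / (q.mu / 4 - q.kapCStar) ≤ q.Rσ) :
    ExistsUniformAcrossSmall 𝓣 α Rσ₀ θ₀ :=
  have hpos := q.stdRates_pos hq hp hη
  acrossSmall_of_walks_thresholds hall hq (q.stdRates hq hp hη) hpos.1 hpos.2.1 hθ₀ hα hαR hRσ hαsmall hRσlarge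

end Thresholds

end Literature.MathematicalPhysics.QuantumFieldTheory.Balaban1983to89.NodeOLettersOfWalksAcross

end
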